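import Mathlib.NumberTheory.DirichletCharacter.Basic
import Mathlib.NumberTheory.MulChar.Duality
import Mathlib.RingTheory.RootsOfUnity.AlgebraicallyClosed
import Mathlib.Analysis.Complex.Polynomial.Basic
import Mathlib.Data.ZMod.Units
import Mathlib.GroupTheory.QuotientGroup.Finite
import HarnessLib

/-!
# Existence of Dirichlet characters with prescribed parity and primitivity (support for Aoki 1983, §§3, 6)

Support file IV (everything PROVED; no named facts, no definitions) for the structure theorem of
the Hodge characters of the Fermat surface (`AokiShioda1983_thmB2m_standard`). The rigidity
lemmas (`FermatHodgeCharacterRigidity`) and the determination of Aoki's group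
`U(m) = {u : χ(u) = 1 for all odd primitive χ mod m}` ([Aoki1983, Prop. 6.1]) need the
non-emptiness of the sets `PC⁺(n)`, `PC⁻(n)` of even / odd primitive characters and characters
separating a given unit from `1`; these are supplied here from the duality of finite abelian
groups (`MulChar.exists_apply_ne_one_of_hasEnoughRootsOfUnity`,
`CommGroup.exists_apply_ne_one_of_hasEnoughRootsOfUnity`):

* `exists_char_apply_ne_one` (separation), `exists_odd_char` (`N > 2`),
  `exists_even_char_apply_ne_one` (separation by EVEN characters of units `g ≠ ±1`, through the
  quotient `(ℤ/N)ˣ/{±1}`);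
* prime powers: `isPrimitive_of_not_factorsThrough_primePow` (a character mod `p^e` not
  factoring through `p^(e-1)` is primitive), `exists_odd_isPrimitive_primePow`,
  `exists_even_isPrimitive_primePow` (both parities occur among primitive characters mod `p^e`
  when `e ≥ 2`, `p^e ≠ 4`; [Aoki1983, §3, "`PC⁺(3)`, `PC⁺(4)` are empty"]);
* primes: `exists_odd_isPrimitive_prime`, `exists_even_isPrimitive_prime` (`p ≥ 5`);
* `odd_of_ne_one_of_units_eq`, `odd_of_ne_one_three`, `odd_of_ne_one_four` (mod `3` and mod `4`
  every non-trivial character is odd).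

## References

* [Aoki1983] N. Aoki, On some arithmetic problems related to the Hodge cycles on the Fermat
  varieties, Math. Ann. 266 (1983) 23–54, §3 (p. 28) and §6 (text read).
-/

noncomputable section

open Finset

namespace Literature.AlgebraicGeometry.HodgeTheory

namespace FermatCharacter

/-! ### Separation -/

/-- **Characters separate units from `1`**: for `g ≠ 1` in `ℤ/N` there is a Dirichlet
character `χ` mod `N` with `χ(g) ≠ 1`. [folklore] -/
theorem exists_char_apply_ne_one {N : ℕ} [NeZero N] {g : ZMod N} (hg : g ≠ 1) :
    ∃ χ : DirichletCharacter ℂ N, χ g ≠ 1 :=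
  MulChar.exists_apply_ne_one_of_hasEnoughRootsOfUnity (ZMod N) ℂ hg

/-- **Odd characters exist** mod `N > 2` (separate `-1 ≠ 1`). [folklore] -/
theorem exists_odd_char {N : ℕ} [NeZero N] (hN : 2 < N) :
    ∃ χ : DirichletCharacter ℂ N, χ.Odd := by
  have hne : (-1 : ZMod N) ≠ 1 := by
    intro h
    have h2 : ((2 : ℕ) : ZMod N) = 0 := by
      push_cast
      linear_combination -h
    rw [ZMod.natCast_eq_zero_iff] at h2
    exact absurd (Nat.le_of_dvd two_pos h2) (not_le.mpr hN)
  obtain ⟨χ, hχ⟩ := exists_char_apply_ne_one hne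
  have hsq : χ (-1) * χ (-1) = 1 := by rw [← map_mul, neg_one_mul, neg_neg, map_one]
  rcases mul_self_eq_one_iff.mp hsq with h1 | h1
  · exact absurd h1 hχ
  · exact ⟨χ, h1⟩

/-- **Even characters separate units `g ≠ ±1` from `1`**: there is an even Dirichlet character
`χ` mod `N` with `χ(g) ≠ 1` (a character of the quotient `(ℤ/N)ˣ/{±1}` non-trivial at the image
of `g`). [folklore] -/
theorem exists_even_char_apply_ne_one {N : ℕ} [NeZero N] (g : (ZMod N)ˣ) (hg1 : g ≠ 1)
    (hg2 : g ≠ -1) : ∃ χ : DirichletCharacter ℂ N, χ.Even ∧ χ g ≠ 1 := by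
  classical
  set H : Subgroup (ZMod N)ˣ := Subgroup.zpowers (-1) with hH
  have hgH : (QuotientGroup.mk g : (ZMod N)ˣ ⧸ H) ≠ 1 := by
    intro h1
    rw [QuotientGroup.eq_one_iff, hH, Subgroup.mem_zpowers_iff] at h1
    obtain ⟨k, hk⟩ := h1
    have hsq : (-1 : (ZMod N)ˣ) ^ (2 : ℤ) = 1 := by rw [zpow_two, neg_mul_neg, one_mul]
    obtain ⟨j, rfl | rfl⟩ := Int.even_or_odd' k
    · rw [zpow_mul, hsq, one_zpow] at hk
      exact hg1 hk.symm
    · rw [zpow_add, zpow_mul, hsq, one_zpow, one_mul, zpow_one] at hk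
      exact hg2 hk.symm
  haveI : Finite ((ZMod N)ˣ ⧸ H) := inferInstance
  haveI : NeZero (Monoid.exponent ((ZMod N)ˣ ⧸ H)) :=
    ⟨Monoid.exponent_ne_zero.mpr (Monoid.ExponentExists.of_finite (G := (ZMod N)ˣ ⧸ H))⟩
  obtain ⟨φ, hφ⟩ := CommGroup.exists_apply_ne_one_of_hasEnoughRootsOfUnity
    ((ZMod N)ˣ ⧸ H) ℂ hgH
  set ψ : (ZMod N)ˣ →* ℂˣ := φ.comp (QuotientGroup.mk' H) with hψ
  refine ⟨MulChar.ofUnitHom ψ, ?_, ?_⟩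
  · rw [DirichletCharacter.Even, show (-1 : ZMod N) = ((-1 : (ZMod N)ˣ) : ZMod N) by simp,
      MulChar.ofUnitHom_coe, hψ, MonoidHom.comp_apply, QuotientGroup.mk'_apply]
    have : (QuotientGroup.mk (-1 : (ZMod N)ˣ) : (ZMod N)ˣ ⧸ H) = 1 := by
      rw [QuotientGroup.eq_one_iff, hH]
      exact Subgroup.mem_zpowers _
    rw [this, map_one, Units.val_one]
  · rw [MulChar.ofUnitHom_coe, hψ, MonoidHom.comp_apply, QuotientGroup.mk'_apply]
    intro h1
    exact hφ (Units.val_eq_one.mp h1)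

/-! ### Prime powers -/

/-- A character mod `p^e` (`e ≥ 1`) that does not factor through `p^(e-1)` is primitive
(its conductor is a power `p^j`, and `j < e` would mean factoring through `p^(e-1)`).
[folklore] -/
theorem isPrimitive_of_not_factorsThrough_primePow {p e : ℕ} (hp : p.Prime) (he : 1 ≤ e)
    (χ : DirichletCharacter ℂ (p ^ e)) (hχ : ¬ χ.FactorsThrough (p ^ (e - 1))) :
    χ.IsPrimitive := by
  haveI : NeZero (p ^ e) := ⟨pow_ne_zero e hp.ne_zero⟩
  rw [DirichletCharacter.isPrimitive_def]
  obtain ⟨j, hj, hjc⟩ := (Nat.dvd_prime_pow hp).mp χ.conductor_dvd_level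
  by_contra hne
  apply hχ
  have hjlt : j < e := lt_of_le_of_ne hj (fun h ↦ hne (by rw [hjc, h]))
  have hdvd : χ.conductor ∣ p ^ (e - 1) := by
    rw [hjc]
    exact pow_dvd_pow p (by omega)
  exact (DirichletCharacter.mem_conductorSet_iff_conductor_dvd χ
    (pow_dvd_pow p (Nat.sub_le e 1))).mpr hdvd

/-- Conversely a character non-trivial on a unit `z ≡ 1 (mod d)` does not factor through `d`.
[folklore] -/
theorem not_factorsThrough_of_apply_ne_one {N d : ℕ} [NeZero N] (hd : d ∣ N)
    {χ : DirichletCharacter ℂ N} {z : (ZMod N)ˣ} (hz : ZMod.unitsMap hd z = 1) (hχz : χ z ≠ 1) :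
    ¬ χ.FactorsThrough d := by
  intro hf
  have hk := (DirichletCharacter.factorsThrough_iff_ker_unitsMap hd).mp hf
    ((MonoidHom.mem_ker).mpr hz)
  rw [MonoidHom.mem_ker] at hk
  apply hχz
  have := congrArg (fun u : ℂˣ ↦ (u : ℂ)) hk
  simpa [MulChar.coe_toUnitHom] using this

/-- The unit `z = 1 + p^(e-1)` of `ℤ/p^e` (`e ≥ 2`): it reduces to `1` mod `p^(e-1)` and is
different from `1`, and from `-1` unless `p^e = 4`. [folklore] -/
theorem exists_unit_one_add_primePow {p e : ℕ} (hp : p.Prime) (he : 2 ≤ e) (h4 : p ^ e ≠ 4) :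
    ∃ z : (ZMod (p ^ e))ˣ, ZMod.unitsMap (pow_dvd_pow p (Nat.sub_le e 1)) z = 1 ∧ z ≠ 1 ∧
      z ≠ -1 := by
  haveI : NeZero (p ^ e) := ⟨pow_ne_zero e hp.ne_zero⟩
  have hpe : (p : ZMod (p ^ e)) ^ e = 0 := by
    rw [← Nat.cast_pow, ZMod.natCast_self]
  -- `z` is a unit: `(1 + p^(e-1)) (1 - p^(e-1)) = 1`
  have hsq : ((p : ZMod (p ^ e)) ^ (e - 1)) ^ 2 = 0 := by
    rw [← pow_mul]
    obtain ⟨k, hk⟩ := Nat.exists_eq_add_of_le (show e ≤ (e - 1) * 2 by omega)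
    rw [hk, pow_add, hpe, zero_mul]
  have hunit : IsUnit (1 + (p : ZMod (p ^ e)) ^ (e - 1)) := by
    refine IsUnit.of_mul_eq_one (1 - (p : ZMod (p ^ e)) ^ (e - 1)) ?_
    linear_combination (-1 : ZMod (p ^ e)) * hsq
  refine ⟨hunit.unit, ?_, ?_, ?_⟩
  · ext
    rw [ZMod.unitsMap_val, hunit.unit_spec, Units.val_one, ← ZMod.castHom_apply
      (h := pow_dvd_pow p (Nat.sub_le e 1)), map_add, map_one, map_pow, map_natCast,
      ← Nat.cast_pow, ZMod.natCast_self, add_zero]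
  · intro h1
    have h1' := congrArg (fun u : (ZMod (p ^ e))ˣ ↦ (u : ZMod (p ^ e))) h1
    simp only [IsUnit.unit_spec, Units.val_one, add_eq_left] at h1'
    rw [← Nat.cast_pow, ZMod.natCast_eq_zero_iff] at h1'
    have := Nat.le_of_dvd (pow_pos hp.pos _) h1'
    have hlt : p ^ (e - 1) < p ^ e := Nat.pow_lt_pow_right hp.one_lt (by omega)
    omega
  · intro h1
    have h1' := congrArg (fun u : (ZMod (p ^ e))ˣ ↦ (u : ZMod (p ^ e))) h1
    simp only [IsUnit.unit_spec, Units.val_neg, Units.val_one] at h1'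
    -- `2 + p^(e-1) = 0` in `ℤ/p^e`
    have h2 : ((2 + p ^ (e - 1) : ℕ) : ZMod (p ^ e)) = 0 := by
      push_cast
      linear_combination h1'
    rw [ZMod.natCast_eq_zero_iff] at h2
    have hle := Nat.le_of_dvd (by positivity) h2
    -- `p^e ≤ 2 + p^(e-1)` forces `p^e = 4`
    have hpe' : p ^ e = p * p ^ (e - 1) := by
      rw [← pow_succ']
      congr 1
      omega
    have hpow : 1 ≤ p ^ (e - 1) := Nat.one_le_pow _ _ hp.pos
    have hp2' : p ≤ 2 := by
      by_contra hlt
      push Not at hlt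
      have h3 : 3 * p ^ (e - 1) ≤ p * p ^ (e - 1) := Nat.mul_le_mul_right _ hlt
      have hb : p ≤ p ^ (e - 1) := by
        calc p = p ^ 1 := (pow_one p).symm
          _ ≤ p ^ (e - 1) := Nat.pow_le_pow_right hp.pos (by omega)
      omega
    have hp_eq : p = 2 := le_antisymm hp2' hp.two_le
    subst hp_eq
    have h22 : 2 ^ (e - 1) ≤ 2 := by omega
    have he1 : e - 1 ≤ 1 := by
      by_contra hlt
      push Not at hlt
      have : 2 ^ 2 ≤ 2 ^ (e - 1) := Nat.pow_le_pow_right two_pos hlt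
      omega
    have he2 : e = 2 := by omega
    subst he2
    exact h4 rfl

/-- **Even primitive characters mod `p^e`** (`e ≥ 2`, `p^e ≠ 4`): separate `z = 1 + p^(e-1)`
from `1` by an even character. [cite: Aoki1983, §3 (p. 28)] -/
theorem exists_even_isPrimitive_primePow {p e : ℕ} (hp : p.Prime) (he : 2 ≤ e) (h4 : p ^ e ≠ 4) :
    ∃ χ : DirichletCharacter ℂ (p ^ e), χ.Even ∧ χ.IsPrimitive := by
  haveI : NeZero (p ^ e) := ⟨pow_ne_zero e hp.ne_zero⟩
  obtain ⟨z, hz, hz1, hz2⟩ := exists_unit_one_add_primePow hp he h4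
  obtain ⟨χ, heven, hχz⟩ := exists_even_char_apply_ne_one z hz1 hz2
  exact ⟨χ, heven, isPrimitive_of_not_factorsThrough_primePow hp (by omega) χ
    (not_factorsThrough_of_apply_ne_one _ hz hχz)⟩

/-- **Odd primitive characters mod `p^e`** (`e ≥ 2`, `p^e ≠ 4`): an odd character `χ₂`; if it
is trivial on `z`, multiply it by an even primitive one. [cite: Aoki1983, §3 (p. 28)] -/
theorem exists_odd_isPrimitive_primePow {p e : ℕ} (hp : p.Prime) (he : 2 ≤ e) (h4 : p ^ e ≠ 4) :
    ∃ χ : DirichletCharacter ℂ (p ^ e), χ.Odd ∧ χ.IsPrimitive := by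
  haveI : NeZero (p ^ e) := ⟨pow_ne_zero e hp.ne_zero⟩
  obtain ⟨z, hz, hz1, hz2⟩ := exists_unit_one_add_primePow hp he h4
  have hgt : 2 < p ^ e := by
    have h4' : 4 ≤ p ^ e := by
      calc 4 = 2 ^ 2 := by norm_num
        _ ≤ p ^ 2 := Nat.pow_le_pow_left hp.two_le 2
        _ ≤ p ^ e := Nat.pow_le_pow_right hp.pos he
    omega
  obtain ⟨χ₂, hodd⟩ := exists_odd_char hgt
  by_cases hχz : χ₂ z = 1
  · obtain ⟨χ₃, heven, hχ₃z⟩ := exists_even_char_apply_ne_one z hz1 hz2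
    refine ⟨χ₂ * χ₃, ?_, isPrimitive_of_not_factorsThrough_primePow hp (by omega) _
      (not_factorsThrough_of_apply_ne_one _ hz ?_)⟩
    · rw [DirichletCharacter.Odd, MulChar.mul_apply, hodd, heven]; norm_num
    · rw [MulChar.mul_apply, hχz, one_mul]; exact hχ₃z
  · exact ⟨χ₂, hodd, isPrimitive_of_not_factorsThrough_primePow hp (by omega) _
      (not_factorsThrough_of_apply_ne_one _ hz hχz)⟩

/-! ### Primes -/

/-- A non-trivial character mod a prime is primitive. [folklore] -/
theorem isPrimitive_of_ne_one_prime {p : ℕ} (hp : p.Prime) {χ : DirichletCharacter ℂ p}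
    (hχ : χ ≠ 1) : χ.IsPrimitive := by
  haveI : NeZero p := ⟨hp.ne_zero⟩
  rw [DirichletCharacter.isPrimitive_def]
  rcases (Nat.dvd_prime hp).mp χ.conductor_dvd_level with h1 | h1
  · exact absurd ((DirichletCharacter.eq_one_iff_conductor_eq_one (χ := χ)).mpr h1) hχ
  · exact h1

/-- A character mod a prime not factoring through `1` is primitive (the form used by the
rigidity lemmas with `d = 1`). [folklore] -/
theorem isPrimitive_of_not_factorsThrough_one_prime {p : ℕ} (hp : p.Prime)
    (χ : DirichletCharacter ℂ p) (hχ : ¬ χ.FactorsThrough 1) : χ.IsPrimitive := by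
  refine isPrimitive_of_ne_one_prime hp fun h1 ↦ hχ ?_
  rw [h1]
  exact (DirichletCharacter.factorsThrough_one_iff _).mpr rfl

/-- **Odd (hence primitive) characters mod an odd prime.** [folklore] -/
theorem exists_odd_isPrimitive_prime {p : ℕ} (hp : p.Prime) (hp2 : p ≠ 2) :
    ∃ χ : DirichletCharacter ℂ p, χ.Odd ∧ χ.IsPrimitive := by
  haveI : NeZero p := ⟨hp.ne_zero⟩
  have hgt : 2 < p := lt_of_le_of_ne hp.two_le (Ne.symm hp2)
  obtain ⟨χ, hodd⟩ := exists_odd_char hgt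
  refine ⟨χ, hodd, isPrimitive_of_ne_one_prime hp fun h1 ↦ ?_⟩
  rw [h1, DirichletCharacter.Odd] at hodd
  have : (1 : DirichletCharacter ℂ p) (-1) = 1 := by
    rw [show (-1 : ZMod p) = ((-1 : (ZMod p)ˣ) : ZMod p) by simp, MulChar.one_apply_coe]
  rw [this] at hodd
  norm_num at hodd

/-- **Even primitive characters mod a prime `p ≥ 5`**: separate the unit `2 ≠ ±1` by an even
character. [folklore] -/
theorem exists_even_isPrimitive_prime {p : ℕ} (hp : p.Prime) (hp5 : 5 ≤ p) :
    ∃ χ : DirichletCharacter ℂ p, χ.Even ∧ χ.IsPrimitive := by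
  haveI : NeZero p := ⟨hp.ne_zero⟩
  have h2u : IsUnit (2 : ZMod p) := by
    rw [show (2 : ZMod p) = ((2 : ℕ) : ZMod p) by norm_cast,
      ZMod.isUnit_prime_iff_not_dvd Nat.prime_two]
    intro h
    have := (Nat.prime_dvd_prime_iff_eq Nat.prime_two hp).mp h
    omega
  have hne1 : h2u.unit ≠ 1 := by
    intro h1
    have h1' := congrArg (fun u : (ZMod p)ˣ ↦ (u : ZMod p)) h1
    simp only [IsUnit.unit_spec, Units.val_one] at h1'
    have : ((1 : ℕ) : ZMod p) = 0 := by
      push_cast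
      linear_combination h1'
    rw [ZMod.natCast_eq_zero_iff] at this
    exact absurd (Nat.le_of_dvd one_pos this) (by omega)
  have hne2 : h2u.unit ≠ -1 := by
    intro h1
    have h1' := congrArg (fun u : (ZMod p)ˣ ↦ (u : ZMod p)) h1
    simp only [IsUnit.unit_spec, Units.val_neg, Units.val_one] at h1'
    have : ((3 : ℕ) : ZMod p) = 0 := by
      push_cast
      linear_combination h1'
    rw [ZMod.natCast_eq_zero_iff] at this
    exact absurd (Nat.le_of_dvd three_pos this) (by omega)
  obtain ⟨χ, heven, hχ⟩ := exists_even_char_apply_ne_one h2u.unit hne1 hne2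
  refine ⟨χ, heven, isPrimitive_of_ne_one_prime hp fun h1 ↦ hχ ?_⟩
  rw [h1, MulChar.one_apply_coe]

/-! ### Levels `3` and `4`: every non-trivial character is odd -/

/-- If the only units of `ℤ/N` are `±1` (`N = 3, 4, 6`), a character which is even is trivial;
so every non-trivial character is odd ([Aoki1983, §3]: "`PC⁺(3)`, `PC⁺(4)` are empty").
[cite: Aoki1983, §3 (p. 28)] -/
theorem odd_of_ne_one_of_units_eq {N : ℕ} [NeZero N] (hN : ∀ u : (ZMod N)ˣ, u = 1 ∨ u = -1)
    {χ : DirichletCharacter ℂ N} (hχ : χ ≠ 1) : χ.Odd := by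
  have hsq : χ (-1) * χ (-1) = 1 := by rw [← map_mul, neg_one_mul, neg_neg, map_one]
  rcases mul_self_eq_one_iff.mp hsq with h1 | h1
  · exfalso
    apply hχ
    apply MulChar.ext
    intro u
    rcases hN u with rfl | rfl
    · rw [Units.val_one, map_one, map_one]
    · rw [MulChar.one_apply_coe, Units.val_neg, Units.val_one, h1]
  · exact h1

/-- Mod `3` every non-trivial character is odd (`(ℤ/3)ˣ = {±1}`; "`PC⁺(3)` is empty").
[cite: Aoki1983, §3 (p. 28)] -/
theorem odd_of_ne_one_three {χ : DirichletCharacter ℂ 3} (hχ : χ ≠ 1) : χ.Odd :=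
  odd_of_ne_one_of_units_eq (fun u ↦ by fin_cases u <;> decide) hχ

/-- Mod `4` every non-trivial character is odd (`(ℤ/4)ˣ = {±1}`; "`PC⁺(4)` is empty").
[cite: Aoki1983, §3 (p. 28)] -/
theorem odd_of_ne_one_four {χ : DirichletCharacter ℂ 4} (hχ : χ ≠ 1) : χ.Odd :=
  odd_of_ne_one_of_units_eq (fun u ↦ by fin_cases u <;> decide) hχ

end FermatCharacter

end Literature.AlgebraicGeometry.HodgeTheory
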